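import Summits.CriticalPhenomena.SAWScalingLimit.Theorems.SAWDefectDecoherenceBoundaryClosureRPolygonLocalCornerLevels
import HarnessLib

/-!
# Pinning of the two lattice thresholds at an exact corner
(crux `BoundaryClosureR`, stmt-CriticalPhenomena-14004, line `polygon-parity-squeeze`, sub-goal of the
registered stub `polygonLocalIdentity`, step (b)/K4; registered helper `corner_pinning`)

At a corner `z` of the datum (inside `B(z, s)` the carrier is the intersection or the union of the two
zigzag half-planes `H_k(z)`, `H_{k'}(z)`, `n_{k'} ≠ ±n_k`) where the family `Λ_δ` is eventually the
intersection or the union of two exact half-lattices `{nk ≤ zigzagForm k}`, `{nk' ≤ zigzagForm k'}` on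
the ball, the two thresholds are PINNED to the corner: for every `t > 0`, eventually the threshold
levels `δ(√3/2)·nk - Re(z conj n_k)` and `δ(√3/2)·nk' - Re(z conj n_{k'})` are both `≤ t` in absolute
value, and the lattice form (∧/∨) agrees with the continuum form (∩/∪).  Ingredients: the centres of
`Λ_δ` lie in the carrier, compacts of the carrier are eventually filled (`AdmissibleFamily`), face
centres are dense, and test points with prescribed levels in the two frames exist
(`exists_point_with_levels` of `…PolygonLocalCornerLevels`).

References: folklore (geometry of the honeycomb lattice).  No definition is introduced.
-/

noncomputable section

open scoped Topology ComplexConjugate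
open Filter Set Metric
open Literature.Probability.LatticeModels Literature.Probability.RandomPlanarGeometry
open Literature.Probability.RandomPlanarGeometry.SAW
open Summit.CriticalPhenomena.SAWScalingLimit.Theorems.PickHalfPlane
open Summit.CriticalPhenomena.SAWScalingLimit.Theorems.PolygonParitySqueeze.PhaseGeometry (re_mul_conj_innerNormal
  innerNormal_opp)

namespace Summit.CriticalPhenomena.SAWScalingLimit.Theorems.PolygonParitySqueeze.PolygonLocal

/-! ### Pinning of the thresholds -/

/-- **Pinning of the two thresholds at an exact corner, small `t`.**  See `corner_pinning`; here
`t ≤ s/100` and the bounds are `3t`. [folklore] -/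
theorem corner_pinning_small {D : DobrushinDomain} {ρ : ℝ} {Λ : ℝ → Finset HexVertex} {m : ℝ → ℤ}
    {b : ℝ → Sym2 HexVertex} (hAF : AdmissibleFamily D ρ Λ m b) {z : ℂ} {k k' : Fin 6} {s : ℝ}
    (hne : innerNormal k' ≠ innerNormal k) (hne' : innerNormal k' ≠ -innerNormal k)
    (hsetC : D.carrier ∩ ball z s = halfPlane k z ∩ halfPlane k' z ∩ ball z s ∨
      D.carrier ∩ ball z s = (halfPlane k z ∪ halfPlane k' z) ∩ ball z s)
    {t : ℝ} (ht : 0 < t) (hts : t ≤ s / 100) :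
    ∀ᶠ δ : ℝ in 𝓝[>] 0, ∀ nk nk' : ℤ,
      ((∀ v : HexVertex, (δ : ℂ) * hexCenter v ∈ ball z s → (v ∈ Λ δ ↔ (nk ≤ zigzagForm k v ∧ nk' ≤ zigzagForm k' v))) →
        D.carrier ∩ ball z s = halfPlane k z ∩ halfPlane k' z ∩ ball z s ∧
        |δ * (Real.sqrt 3 / 2) * nk - (z * conj (innerNormal k)).re| ≤ 3 * t ∧
        |δ * (Real.sqrt 3 / 2) * nk' - (z * conj (innerNormal k')).re| ≤ 3 * t) ∧
      ((∀ v : HexVertex, (δ : ℂ) * hexCenter v ∈ ball z s → (v ∈ Λ δ ↔ (nk ≤ zigzagForm k v ∨ nk' ≤ zigzagForm k' v))) →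
        D.carrier ∩ ball z s = (halfPlane k z ∪ halfPlane k' z) ∩ ball z s ∧
        |δ * (Real.sqrt 3 / 2) * nk - (z * conj (innerNormal k)).re| ≤ 3 * t ∧
        |δ * (Real.sqrt 3 / 2) * nk' - (z * conj (innerNormal k')).re| ≤ 3 * t) := by
  have hexh := hAF.2.2.2.1
  have hcenev := hAF.2.2.1
  ---------------------------------------------------------------- test points and compacts
  have hq := exists_point_with_levels hne hne' z
  obtain ⟨q₁, hq₁, hq₁', hq₁d⟩ := hq (2 * t) (2 * t)
  obtain ⟨q₂, hq₂, hq₂', hq₂d⟩ := hq (2 * t) (-(6 * t))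
  obtain ⟨q₃, hq₃, hq₃', hq₃d⟩ := hq (-(6 * t)) (2 * t)
  have habs1 : |2 * t| = 2 * t := abs_of_pos (by linarith)
  have habs2 : |(-(6 * t))| = 6 * t := by rw [abs_neg, abs_of_pos (by linarith)]
  simp only [habs1, habs2] at hq₁d hq₂d hq₃d
  -- levels of points of small balls about the test points
  have hlev : ∀ (j : Fin 6) (q w : ℂ), |((w - z) * conj (innerNormal j)).re - ((q - z) * conj (innerNormal j)).re| ≤ dist w q :=
    fun j q w => by
      rw [show ((w - z) * conj (innerNormal j)).re - ((q - z) * conj (innerNormal j)).re =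
        ((w - q) * conj (innerNormal j)).re by rw [← Complex.sub_re, ← sub_mul, sub_sub_sub_cancel_right]]
      exact abs_level_le_dist j q w
  have hK : ∀ q : ℂ, dist q z ≤ 24 * t → ∀ w ∈ closedBall q (t / 2), w ∈ ball z s := fun q hqz w hw => by
    rw [mem_closedBall] at hw; rw [mem_ball]; have := dist_triangle w q z; linarith
  have hK₁D : closedBall q₁ (t / 2) ⊆ D.carrier := by
    intro w hw
    have hwz : w ∈ ball z s := hK q₁ (by linarith) w hw
    rw [mem_closedBall] at hw
    have h1 : 0 < ((w - z) * conj (innerNormal k)).re := by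
      have := (abs_le.1 (hlev k q₁ w)).1; linarith
    have h2 : 0 < ((w - z) * conj (innerNormal k')).re := by
      have := (abs_le.1 (hlev k' q₁ w)).1; linarith
    rcases hsetC with h | h
    · have : w ∈ halfPlane k z ∩ halfPlane k' z ∩ ball z s := ⟨⟨h1, h2⟩, hwz⟩
      rw [← h] at this; exact this.1
    · have : w ∈ (halfPlane k z ∪ halfPlane k' z) ∩ ball z s := ⟨Or.inl h1, hwz⟩
      rw [← h] at this; exact this.1
  have hsmall : ∀ᶠ δ : ℝ in 𝓝[>] 0, δ < t / 100 := nhdsWithin_le_nhds (eventually_lt_nhds (by positivity))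
  ---------------------------------------------------------------- the two continuum branches
  rcases hsetC with hcap | hcup
  · ------------------------------------------------------------ convex corner
    filter_upwards [hcenev, hexh _ (isCompact_closedBall q₁ (t / 2)) hK₁D, hsmall, self_mem_nhdsWithin]
      with δ hcen hK₁ hδt hδ0
    have hδ0 : (0 : ℝ) < δ := hδ0
    have hcen' : ∀ v ∈ Λ δ, (δ : ℂ) * hexCenter v ∈ D.carrier := hcen.2.2.2.1
    -- faces near test points
    have hface : ∀ q : ℂ, ∃ w : HexVertex, dist ((δ : ℂ) * hexCenter w) q ≤ 2 * δ ∧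
        |(((δ : ℂ) * hexCenter w - z) * conj (innerNormal k)).re - ((q - z) * conj (innerNormal k)).re| ≤ 2 * δ ∧
        |(((δ : ℂ) * hexCenter w - z) * conj (innerNormal k')).re - ((q - z) * conj (innerNormal k')).re| ≤ 2 * δ :=
      fun q => by
        obtain ⟨w, hw⟩ := exists_smul_hexCenter_near hδ0 q
        exact ⟨w, hw, (hlev k q _).trans hw, (hlev k' q _).trans hw⟩
    -- membership in `D` forces positive levels
    have hDlev : ∀ w : HexVertex, w ∈ Λ δ → (δ : ℂ) * hexCenter w ∈ ball z s →
        0 < (((δ : ℂ) * hexCenter w - z) * conj (innerNormal k)).re ∧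
        0 < (((δ : ℂ) * hexCenter w - z) * conj (innerNormal k')).re := fun w hw hwb => by
      have : (δ : ℂ) * hexCenter w ∈ D.carrier ∩ ball z s := ⟨hcen' w hw, hwb⟩
      rw [hcap] at this
      exact ⟨(mem_halfPlane_iff_level k z _).1 this.1.1, (mem_halfPlane_iff_level k' z _).1 this.1.2⟩
    intro nk nk'
    set A : ℝ := δ * (Real.sqrt 3 / 2) * nk - (z * conj (innerNormal k)).re with hA
    set A' : ℝ := δ * (Real.sqrt 3 / 2) * nk' - (z * conj (innerNormal k')).re with hA'
    -- the face in `K₁`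
    obtain ⟨w₁, hw₁, hw₁k, hw₁k'⟩ := hface q₁
    have hw₁K : (δ : ℂ) * hexCenter w₁ ∈ closedBall q₁ (t / 2) := mem_closedBall.2 (by linarith)
    have hw₁Λ : w₁ ∈ Λ δ := hK₁ w₁ hw₁K
    have hw₁b : (δ : ℂ) * hexCenter w₁ ∈ ball z s := hK q₁ (by linarith) _ hw₁K
    have hlk₁ := (abs_le.1 hw₁k).2
    have hlk₁' := (abs_le.1 hw₁k').2
    constructor
    · ---------------------------------------------------------- lattice `∧`
      intro hform
      obtain ⟨hf₁, hf₁'⟩ := (hform w₁ hw₁b).1 hw₁Λ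
      -- upper pins
      have hAu : A ≤ 3 * t := by
        by_contra hlt; push Not at hlt
        exact not_threshold_le_form_of_level hδ0 k w₁ nk z (by rw [hq₁] at hlk₁; rw [← hA]; linarith) hf₁
      have hAu' : A' ≤ 3 * t := by
        by_contra hlt; push Not at hlt
        exact not_threshold_le_form_of_level hδ0 k' w₁ nk' z (by rw [hq₁'] at hlk₁'; rw [← hA']; linarith) hf₁'
      -- lower pins
      have hAl : -(3 * t) ≤ A := by
        by_contra hlt; push Not at hlt
        obtain ⟨q₄, hq₄, hq₄', hq₄d⟩ := hq (-(2 * t)) (4 * t)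
        rw [abs_neg, abs_of_pos (by linarith : (0 : ℝ) < 2 * t), abs_of_pos (by linarith : (0 : ℝ) < 4 * t)] at hq₄d
        obtain ⟨w, hw, hwk, hwk'⟩ := hface q₄
        rw [hq₄] at hwk; rw [hq₄'] at hwk'
        have hwb : (δ : ℂ) * hexCenter w ∈ ball z s := mem_ball.2 (by
          have := dist_triangle ((δ : ℂ) * hexCenter w) q₄ z; linarith)
        have h1 : nk ≤ zigzagForm k w :=
          threshold_le_form_of_level hδ0 k w nk z (by rw [← hA]; have := (abs_le.1 hwk).1; linarith)
        have h2 : nk' ≤ zigzagForm k' w :=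
          threshold_le_form_of_level hδ0 k' w nk' z (by rw [← hA']; have := (abs_le.1 hwk').1; linarith)
        have hwΛ : w ∈ Λ δ := (hform w hwb).2 ⟨h1, h2⟩
        have := (hDlev w hwΛ hwb).1
        have := (abs_le.1 hwk).2
        linarith
      have hAl' : -(3 * t) ≤ A' := by
        by_contra hlt; push Not at hlt
        obtain ⟨q₅, hq₅, hq₅', hq₅d⟩ := hq (4 * t) (-(2 * t))
        rw [abs_neg, abs_of_pos (by linarith : (0 : ℝ) < 2 * t), abs_of_pos (by linarith : (0 : ℝ) < 4 * t)] at hq₅d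
        obtain ⟨w, hw, hwk, hwk'⟩ := hface q₅
        rw [hq₅] at hwk; rw [hq₅'] at hwk'
        have hwb : (δ : ℂ) * hexCenter w ∈ ball z s := mem_ball.2 (by
          have := dist_triangle ((δ : ℂ) * hexCenter w) q₅ z; linarith)
        have h1 : nk ≤ zigzagForm k w :=
          threshold_le_form_of_level hδ0 k w nk z (by rw [← hA]; have := (abs_le.1 hwk).1; linarith)
        have h2 : nk' ≤ zigzagForm k' w :=
          threshold_le_form_of_level hδ0 k' w nk' z (by rw [← hA']; have := (abs_le.1 hwk').1; linarith)
        have hwΛ : w ∈ Λ δ := (hform w hwb).2 ⟨h1, h2⟩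
        have := (hDlev w hwΛ hwb).2
        have := (abs_le.1 hwk').2
        linarith
      exact ⟨hcap, abs_le.2 ⟨hAl, hAu⟩, abs_le.2 ⟨hAl', hAu'⟩⟩
    · ---------------------------------------------------------- lattice `∨` is impossible
      intro hform
      exfalso
      rcases (hform w₁ hw₁b).1 hw₁Λ with hf₁ | hf₁'
      · have hAu : A ≤ 3 * t := by
          by_contra hlt; push Not at hlt
          exact not_threshold_le_form_of_level hδ0 k w₁ nk z (by rw [hq₁] at hlk₁; rw [← hA]; linarith) hf₁
        obtain ⟨q₅, hq₅, hq₅', hq₅d⟩ := hq (4 * t) (-(2 * t))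
        rw [abs_neg, abs_of_pos (by linarith : (0 : ℝ) < 2 * t), abs_of_pos (by linarith : (0 : ℝ) < 4 * t)] at hq₅d
        obtain ⟨w, hw, hwk, hwk'⟩ := hface q₅
        rw [hq₅] at hwk; rw [hq₅'] at hwk'
        have hwb : (δ : ℂ) * hexCenter w ∈ ball z s := mem_ball.2 (by
          have := dist_triangle ((δ : ℂ) * hexCenter w) q₅ z; linarith)
        have h1 : nk ≤ zigzagForm k w :=
          threshold_le_form_of_level hδ0 k w nk z (by rw [← hA]; have := (abs_le.1 hwk).1; linarith)
        have hwΛ : w ∈ Λ δ := (hform w hwb).2 (Or.inl h1)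
        have := (hDlev w hwΛ hwb).2
        have := (abs_le.1 hwk').2
        linarith
      · have hAu' : A' ≤ 3 * t := by
          by_contra hlt; push Not at hlt
          exact not_threshold_le_form_of_level hδ0 k' w₁ nk' z (by rw [hq₁'] at hlk₁'; rw [← hA']; linarith) hf₁'
        obtain ⟨q₄, hq₄, hq₄', hq₄d⟩ := hq (-(2 * t)) (4 * t)
        rw [abs_neg, abs_of_pos (by linarith : (0 : ℝ) < 2 * t), abs_of_pos (by linarith : (0 : ℝ) < 4 * t)] at hq₄d
        obtain ⟨w, hw, hwk, hwk'⟩ := hface q₄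
        rw [hq₄] at hwk; rw [hq₄'] at hwk'
        have hwb : (δ : ℂ) * hexCenter w ∈ ball z s := mem_ball.2 (by
          have := dist_triangle ((δ : ℂ) * hexCenter w) q₄ z; linarith)
        have h2 : nk' ≤ zigzagForm k' w :=
          threshold_le_form_of_level hδ0 k' w nk' z (by rw [← hA']; have := (abs_le.1 hwk').1; linarith)
        have hwΛ : w ∈ Λ δ := (hform w hwb).2 (Or.inr h2)
        have := (hDlev w hwΛ hwb).1
        have := (abs_le.1 hwk).2
        linarith
  · ------------------------------------------------------------ reflex corner
    have hK₂D : closedBall q₂ (t / 2) ⊆ D.carrier := by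
      intro w hw
      have hwz : w ∈ ball z s := hK q₂ (by linarith) w hw
      rw [mem_closedBall] at hw
      have h1 : 0 < ((w - z) * conj (innerNormal k)).re := by
        have := (abs_le.1 (hlev k q₂ w)).1; linarith
      have : w ∈ (halfPlane k z ∪ halfPlane k' z) ∩ ball z s := ⟨Or.inl h1, hwz⟩
      rw [← hcup] at this; exact this.1
    have hK₃D : closedBall q₃ (t / 2) ⊆ D.carrier := by
      intro w hw
      have hwz : w ∈ ball z s := hK q₃ (by linarith) w hw
      rw [mem_closedBall] at hw
      have h1 : 0 < ((w - z) * conj (innerNormal k')).re := by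
        have := (abs_le.1 (hlev k' q₃ w)).1; linarith
      have : w ∈ (halfPlane k z ∪ halfPlane k' z) ∩ ball z s := ⟨Or.inr h1, hwz⟩
      rw [← hcup] at this; exact this.1
    filter_upwards [hcenev, hexh _ (isCompact_closedBall q₁ (t / 2)) hK₁D, hexh _ (isCompact_closedBall q₂ (t / 2)) hK₂D,
      hexh _ (isCompact_closedBall q₃ (t / 2)) hK₃D, hsmall, self_mem_nhdsWithin] with δ hcen hK₁ hK₂ hK₃ hδt hδ0
    have hδ0 : (0 : ℝ) < δ := hδ0
    have hcen' : ∀ v ∈ Λ δ, (δ : ℂ) * hexCenter v ∈ D.carrier := hcen.2.2.2.1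
    have hface : ∀ q : ℂ, ∃ w : HexVertex, dist ((δ : ℂ) * hexCenter w) q ≤ 2 * δ ∧
        |(((δ : ℂ) * hexCenter w - z) * conj (innerNormal k)).re - ((q - z) * conj (innerNormal k)).re| ≤ 2 * δ ∧
        |(((δ : ℂ) * hexCenter w - z) * conj (innerNormal k')).re - ((q - z) * conj (innerNormal k')).re| ≤ 2 * δ :=
      fun q => by
        obtain ⟨w, hw⟩ := exists_smul_hexCenter_near hδ0 q
        exact ⟨w, hw, (hlev k q _).trans hw, (hlev k' q _).trans hw⟩
    have hDlev : ∀ w : HexVertex, w ∈ Λ δ → (δ : ℂ) * hexCenter w ∈ ball z s →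
        0 < (((δ : ℂ) * hexCenter w - z) * conj (innerNormal k)).re ∨
        0 < (((δ : ℂ) * hexCenter w - z) * conj (innerNormal k')).re := fun w hw hwb => by
      have : (δ : ℂ) * hexCenter w ∈ D.carrier ∩ ball z s := ⟨hcen' w hw, hwb⟩
      rw [hcup] at this
      rcases this.1 with h | h
      · exact Or.inl ((mem_halfPlane_iff_level k z _).1 h)
      · exact Or.inr ((mem_halfPlane_iff_level k' z _).1 h)
    intro nk nk'
    set A : ℝ := δ * (Real.sqrt 3 / 2) * nk - (z * conj (innerNormal k)).re with hA
    set A' : ℝ := δ * (Real.sqrt 3 / 2) * nk' - (z * conj (innerNormal k')).re with hA'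
    -- the faces in `K₂`, `K₃`
    obtain ⟨w₂, hw₂, hw₂k, hw₂k'⟩ := hface q₂
    have hw₂K : (δ : ℂ) * hexCenter w₂ ∈ closedBall q₂ (t / 2) := mem_closedBall.2 (by linarith)
    have hw₂Λ : w₂ ∈ Λ δ := hK₂ w₂ hw₂K
    have hw₂b : (δ : ℂ) * hexCenter w₂ ∈ ball z s := hK q₂ (by linarith) _ hw₂K
    obtain ⟨w₃, hw₃, hw₃k, hw₃k'⟩ := hface q₃
    have hw₃K : (δ : ℂ) * hexCenter w₃ ∈ closedBall q₃ (t / 2) := mem_closedBall.2 (by linarith)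
    have hw₃Λ : w₃ ∈ Λ δ := hK₃ w₃ hw₃K
    have hw₃b : (δ : ℂ) * hexCenter w₃ ∈ ball z s := hK q₃ (by linarith) _ hw₃K
    rw [hq₂] at hw₂k; rw [hq₂'] at hw₂k'; rw [hq₃] at hw₃k; rw [hq₃'] at hw₃k'
    -- the face below both lines
    obtain ⟨q₆, hq₆, hq₆', hq₆d⟩ := hq (-(2 * t)) (-(2 * t))
    rw [abs_neg, abs_of_pos (by linarith : (0 : ℝ) < 2 * t)] at hq₆d
    obtain ⟨w₆, hw₆, hw₆k, hw₆k'⟩ := hface q₆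
    rw [hq₆] at hw₆k; rw [hq₆'] at hw₆k'
    have hw₆b : (δ : ℂ) * hexCenter w₆ ∈ ball z s := mem_ball.2 (by
      have := dist_triangle ((δ : ℂ) * hexCenter w₆) q₆ z; linarith)
    have hw₆notΛ : w₆ ∉ Λ δ := fun h => by
      rcases hDlev w₆ h hw₆b with h1 | h1
      · have := (abs_le.1 hw₆k).2; linarith
      · have := (abs_le.1 hw₆k').2; linarith
    constructor
    · ---------------------------------------------------------- lattice `∧` is impossible
      intro hform
      exfalso
      obtain ⟨-, hf₂'⟩ := (hform w₂ hw₂b).1 hw₂Λ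
      obtain ⟨hf₃, -⟩ := (hform w₃ hw₃b).1 hw₃Λ
      have hAu' : A' ≤ -(5 * t) := by
        by_contra hlt; push Not at hlt
        exact not_threshold_le_form_of_level hδ0 k' w₂ nk' z (by rw [← hA']; have := (abs_le.1 hw₂k').2; linarith) hf₂'
      have hAu : A ≤ -(5 * t) := by
        by_contra hlt; push Not at hlt
        exact not_threshold_le_form_of_level hδ0 k w₃ nk z (by rw [← hA]; have := (abs_le.1 hw₃k).2; linarith) hf₃
      have h1 : nk ≤ zigzagForm k w₆ :=
        threshold_le_form_of_level hδ0 k w₆ nk z (by rw [← hA]; have := (abs_le.1 hw₆k).1; linarith)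
      have h2 : nk' ≤ zigzagForm k' w₆ :=
        threshold_le_form_of_level hδ0 k' w₆ nk' z (by rw [← hA']; have := (abs_le.1 hw₆k').1; linarith)
      exact hw₆notΛ ((hform w₆ hw₆b).2 ⟨h1, h2⟩)
    · ---------------------------------------------------------- lattice `∨`
      intro hform
      -- lower pins
      have hAl : -(3 * t) ≤ A := by
        by_contra hlt; push Not at hlt
        have h1 : nk ≤ zigzagForm k w₆ :=
          threshold_le_form_of_level hδ0 k w₆ nk z (by rw [← hA]; have := (abs_le.1 hw₆k).1; linarith)
        exact hw₆notΛ ((hform w₆ hw₆b).2 (Or.inl h1))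
      have hAl' : -(3 * t) ≤ A' := by
        by_contra hlt; push Not at hlt
        have h2 : nk' ≤ zigzagForm k' w₆ :=
          threshold_le_form_of_level hδ0 k' w₆ nk' z (by rw [← hA']; have := (abs_le.1 hw₆k').1; linarith)
        exact hw₆notΛ ((hform w₆ hw₆b).2 (Or.inr h2))
      -- upper pins
      have hAu : A ≤ 3 * t := by
        rcases (hform w₂ hw₂b).1 hw₂Λ with hf | hf
        · by_contra hlt; push Not at hlt
          exact not_threshold_le_form_of_level hδ0 k w₂ nk z (by rw [← hA]; have := (abs_le.1 hw₂k).2; linarith) hf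
        · exfalso
          have : A' ≤ -(5 * t) := by
            by_contra hlt; push Not at hlt
            exact not_threshold_le_form_of_level hδ0 k' w₂ nk' z (by rw [← hA']; have := (abs_le.1 hw₂k').2; linarith) hf
          linarith
      have hAu' : A' ≤ 3 * t := by
        rcases (hform w₃ hw₃b).1 hw₃Λ with hf | hf
        · exfalso
          have : A ≤ -(5 * t) := by
            by_contra hlt; push Not at hlt
            exact not_threshold_le_form_of_level hδ0 k w₃ nk z (by rw [← hA]; have := (abs_le.1 hw₃k).2; linarith) hf
          linarith
        · by_contra hlt; push Not at hlt
          exact not_threshold_le_form_of_level hδ0 k' w₃ nk' z (by rw [← hA']; have := (abs_le.1 hw₃k').2; linarith) hf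
      exact ⟨hcup, abs_le.2 ⟨hAl, hAu⟩, abs_le.2 ⟨hAl', hAu'⟩⟩

/-- **Registered helper `corner_pinning`** (sub-goal of `polygonLocalIdentity`, K4): pinning of the
two thresholds at an exact corner and agreement of the lattice form with the continuum form; see the
module docstring. [folklore] -/
theorem corner_pinning : ∀ (D : DobrushinDomain) (ρ : ℝ) (Λ : ℝ → Finset HexVertex) (m : ℝ → ℤ) (b : ℝ → Sym2 HexVertex), AdmissibleFamily D ρ Λ m b → ∀ (z : ℂ) (k k' : Fin 6) (s : ℝ), 0 < s → innerNormal k' ≠ innerNormal k → innerNormal k' ≠ -innerNormal k → (D.carrier ∩ Metric.ball z s = halfPlane k z ∩ halfPlane k' z ∩ Metric.ball z s ∨ D.carrier ∩ Metric.ball z s = (halfPlane k z ∪ halfPlane k' z) ∩ Metric.ball z s) → ∀ t : ℝ, 0 < t → ∀ᶠ δ : ℝ in 𝓝[>] 0, ∀ nk nk' : ℤ, ((∀ v : HexVertex, (δ : ℂ) * hexCenter v ∈ Metric.ball z s → (v ∈ Λ δ ↔ (nk ≤ zigzagForm k v ∧ nk' ≤ zigzagForm k' v))) → D.carrier ∩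 Metric.ball z s = halfPlane k z ∩ halfPlane k' z ∩ Metric.ball z s ∧ |δ * (Real.sqrt 3 / 2) * nk - (z * (starRingEnd ℂ) (innerNormal k)).re| ≤ t ∧ |δ * (Real.sqrt 3 / 2) * nk' - (z * (starRingEnd ℂ) (innerNormal k')).re| ≤ t) ∧ ((∀ v : HexVertex, (δ : ℂ) * hexCenter v ∈ Metric.ball z s → (v ∈ Λ δ ↔ (nk ≤ zigzagForm k v ∨ nk' ≤ zigzagForm k' v))) → D.carrier ∩ Metric.ball z s = (halfPlane k z ∪ halfPlane k' z) ∩ Metric.ball z s ∧ |δ * (Real.sqrt 3 / 2) * nk - (z * (starRingEnd ℂ) (innerNormal k)).re| ≤ t ∧ |δ * (Real.sqrt 3 / 2) * nk' - (z * (starRingEnd ℂ) (innerNormal k')).re| ≤ t) := by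
  intro D ρ Λ m b hAF z k k' s hs hne hne' hsetC t ht
  have _hs := hs
  set t' : ℝ := min (t / 3) (s / 100) with ht'
  have ht'0 : 0 < t' := lt_min (by linarith) (by linarith)
  have h3 : 3 * t' ≤ t := by have := min_le_left (t / 3) (s / 100); linarith
  filter_upwards [corner_pinning_small hAF hne hne' hsetC ht'0 (min_le_right _ _)] with δ hδ nk nk'
  obtain ⟨h1, h2⟩ := hδ nk nk'
  exact ⟨fun hf => let ⟨a1, a2, a3⟩ := h1 hf; ⟨a1, a2.trans h3, a3.trans h3⟩,
    fun hf => let ⟨a1, a2, a3⟩ := h2 hf; ⟨a1, a2.trans h3, a3.trans h3⟩⟩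

end Summit.CriticalPhenomena.SAWScalingLimit.Theorems.PolygonParitySqueeze.PolygonLocal

end
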